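import Summits.HodgeConjecture.HodgeConjecture.Theses.BoundaryReadout

/-!
# Strategy census for `BoundaryAbsoluteness` (stmt-HodgeConjecture-15913) — typed signatures of the
# STRENGTHEN and DECOMPOSITION attempts (elaboration check only; nothing is asserted)
-/

noncomputable section

namespace Summit.HodgeConjecture.HodgeConjecture.Cruxes.BoundaryAbsoluteness.Census

open CategoryTheory AlgebraicGeometry
open Literature.AlgebraicGeometry.Motives Literature.AlgebraicGeometry.HodgeTheory
open Summit.HodgeConjecture.HodgeConjecture.Theses.BoundaryReadout (BoundaryAbsoluteness)

/-! ## Strengthen, attempt 1: `S⁺ = KernelDescent` — absoluteness descends along conjugation-stable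
kernel inclusions (curve-free; the crux = `KernelDescent` + the kernel inclusion for covered fibre vs
smooth fibre on every conjugate family). -/

/-- `S⁺`: for `h_i : Y_i ⟶ X`, `w : W ⟶ X` morphisms of smooth projective varieties such that on EVERY
conjugate `X^σ` a complex class killed by all the `h_i^σ` is killed by `w^σ`, a Hodge class `ξ` on `X`
with all `h_i^* ξ` absolute Hodge has `w^* ξ` absolute Hodge. -/
def KernelDescent : Prop :=
  ∀ ⦃n : ℕ⦄ ⦃X : SchemeOver ℂ⦄, IsSmoothProjective n X →
    ∀ ⦃ι : Type⦄ [Finite ι] ⦃m : ι → ℕ⦄ ⦃Y : ι → SchemeOver ℂ⦄ (h : ∀ i, Y i ⟶ X),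
      (∀ i, IsSmoothProjective (m i) (Y i)) →
      ∀ ⦃nW : ℕ⦄ ⦃W : SchemeOver ℂ⦄ (w : W ⟶ X), IsSmoothProjective nW W →
        (∀ (σ : ℂ ≃+* ℂ) (k : ℕ) (x : complexBetti (conjugateVariety σ X) k),
          (∀ i, complexBetti.map (conjHom σ (h i)) k x = 0) →
            complexBetti.map (conjHom σ w) k x = 0) →
        ∀ (p : ℕ) (ξ : complexBetti X (2 * p)), IsRationalClass ξ → IsOfHodgeType n X (2 * p) p p ξ →
          (∀ i, IsAbsoluteHodgeClass (m i) (Y i) p (complexBetti.map (h i) (2 * p) ξ)) →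
          IsAbsoluteHodgeClass nW W p (complexBetti.map w (2 * p) ξ)

/-- The geometric complement of `S⁺`: on every conjugate of the crux's family, a complex class killed
by the conjugate covering pieces of `X_o` is killed by every smooth projective fibre (the VANISHING
READOUT, = the off-antidiagonal case of `stub_typeReadout`). -/
def FibreKernelInclusion : Prop :=
  ∀ ⦃N : ℕ⦄ ⦃𝒳 C : SchemeOver ℂ⦄ (f : 𝒳 ⟶ C) (o : AlgPoints C ℂ),
    IsSmoothProjective N 𝒳 → IsSmoothProjective 1 C → Function.Surjective f.left.base →
    ∀ ⦃ι : Type⦄ [Finite ι] ⦃m : ι → ℕ⦄ ⦃Y : ι → SchemeOver ℂ⦄ (g : ∀ i, Y i ⟶ fiberOver f o),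
      (∀ i, IsSmoothProjective (m i) (Y i)) →
      (∀ x : ↥(fiberOver f o).left, ∃ (i : ι) (y : ↥(Y i).left), (g i).left.base y = x) →
      ∀ (σ : ℂ ≃+* ℂ) (k : ℕ) (x : complexBetti (conjugateVariety σ 𝒳) k),
        (∀ i, complexBetti.map (conjHom σ (g i ≫ fiberι f o)) k x = 0) →
        ∀ (t : AlgPoints C ℂ) ⦃n : ℕ⦄, IsSmoothProjective n (fiberOver f t) →
          complexBetti.map (conjHom σ (fiberι f t)) k x = 0

/-- `S⁺` + the kernel inclusion give the crux (pure logic). -/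
theorem boundaryAbsoluteness_of_kernelDescent (hK : KernelDescent) (hF : FibreKernelInclusion) :
    BoundaryAbsoluteness := by
  intro N p 𝒳 C f o h𝒳 hC hf ι _ m Y g hY hcov ξ hξr hξh habs t n ht
  exact hK h𝒳 (fun i => g i ≫ fiberι f o) hY (fiberι f t) ht
    (fun σ k x hx => hF f o h𝒳 hC hf g hY hcov σ k x hx t ht) p ξ hξr hξh habs

/-! ## Strengthen, attempt 2: `S⁺⁺ = GlobalAbsoluteness` — conclude absoluteness of `ξ` on the total
space `𝒳` itself. No leverage: for a product family `X × C → C` it contains "Hodge ⟹ absolute Hodge"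
for (Künneth components of) arbitrary classes on `X`, i.e. Charles–Schnell Conj. 11.2.17. -/

/-- `S⁺⁺` (NOT pursued): same hypotheses, conclusion on `𝒳`. -/
def GlobalAbsoluteness : Prop :=
  ∀ (N p : ℕ) (𝒳 C : SchemeOver ℂ) (f : 𝒳 ⟶ C) (o : AlgPoints C ℂ),
    IsSmoothProjective N 𝒳 → IsSmoothProjective 1 C → Function.Surjective f.left.base →
    ∀ (ι : Type) [Finite ι] (m : ι → ℕ) (Y : ι → SchemeOver ℂ) (g : ∀ i, Y i ⟶ fiberOver f o),
      (∀ i, IsSmoothProjective (m i) (Y i)) →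
      (∀ x : ↥(fiberOver f o).left, ∃ (i : ι) (y : ↥(Y i).left), (g i).left.base y = x) →
      ∀ ξ : complexBetti 𝒳 (2 * p), IsRationalClass ξ → IsOfHodgeType N 𝒳 (2 * p) p p ξ →
        (∀ i, IsAbsoluteHodgeClass (m i) (Y i) p
          (complexBetti.map (g i ≫ fiberι f o) (2 * p) ξ)) →
        IsAbsoluteHodgeClass N 𝒳 p ξ

end Summit.HodgeConjecture.HodgeConjecture.Cruxes.BoundaryAbsoluteness.Census

end
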